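import Literature.Analysis.Quadrature.FilonMethod
import HarnessLib

/-!
# Filon's method: the small-`θ` limits of the coefficients (proof of `FilonSmallTheta`)

PROOF LAYER (theorems only) for `Literature/Analysis/Quadrature/FilonMethod.lean` (Davis–Rabinowitz,
*Methods of Numerical Integration*, 2nd ed. 1984, Sect. 2.10.2): the statement file records as a cited fact
`FilonSmallTheta` — (2.10.2.11): `α(θ) → 0`, `β(θ) → 2/3`, `γ(θ) → 4/3` as `θ → 0`, `θ ≠ 0`, for Filon's
coefficients (2.10.2.9). DISCHARGED here (`FilonSmallTheta_holds`) with explicit linear rates, from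
Mathlib's Taylor remainders `Real.sin_bound` (`|sin x − (x − x³/6)| ≤ |x|⁵/100`) and `Real.cos_bound`
(`|cos x − (1 − x²/2)| ≤ (5/96)|x|⁴`) on `|x| ≤ 1`:

* `γ(θ) − 4/3 = 4(E_s − θE_c)/θ³` with `E_s`, `E_c` the remainders at `θ` ⇒ `|γ(θ) − 4/3| ≤ |θ|` (`|θ| ≤ 1`);
* after the double-angle reduction `cos²θ = ½ + ½cos 2θ`, `2 sin θ cos θ = sin 2θ`, with `E₁`, `E₂` the
  remainders at `2θ`: `β(θ) − 2/3 = (θE₂ − 2E₁)/θ³`, `α(θ) = (−(2/3)θ⁴ + θE₁/2 + E₂)/θ³` ⇒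
  `|β(θ) − 2/3| ≤ |θ|`, `|α(θ)| ≤ 2|θ|` (`|θ| ≤ ½`).
-/

open Filter Topology Real

namespace Literature.Analysis.Quadrature


/-- A linear bound near `0` gives the punctured limit. [folklore] -/
private theorem tendsto_punctured_of_abs_sub_le {f : ℝ → ℝ} {L K δ : ℝ} (hδ : 0 < δ) (hK : 0 ≤ K)
    (h : ∀ θ : ℝ, θ ≠ 0 → |θ| ≤ δ → |f θ - L| ≤ K * |θ|) :
    Tendsto f (𝓝[≠] 0) (𝓝 L) := by
  rw [Metric.tendsto_nhdsWithin_nhds]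
  intro ε hε
  refine ⟨min δ (ε / (K + 1)), lt_min hδ (by positivity), fun θ hθ hdist ↦ ?_⟩
  rw [Real.dist_eq, sub_zero] at hdist
  rw [Real.dist_eq]
  have hθδ : |θ| ≤ δ := (hdist.le.trans (min_le_left _ _))
  have hθε : |θ| < ε / (K + 1) := lt_of_lt_of_le hdist (min_le_right _ _)
  have hb := h θ hθ hθδ
  have hK1 : 0 < K + 1 := by linarith
  calc |f θ - L| ≤ K * |θ| := hb
    _ ≤ (K + 1) * |θ| := by nlinarith [abs_nonneg θ]
    _ < (K + 1) * (ε / (K + 1)) := by exact mul_lt_mul_of_pos_left hθε hK1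
    _ = ε := by field_simp

/-- `|γ(θ) − 4/3| ≤ |θ|` for `0 < |θ| ≤ 1`: `sin θ − θ cos θ − θ³/3 = E_s − θ E_c` with the Taylor remainders
`E_s = sin θ − (θ − θ³/6)`, `E_c = cos θ − (1 − θ²/2)`. [cite: DavisRabinowitz1984, Sect. 2.10.2 (2.10.2.11)] -/
private theorem abs_filonGamma_sub_le {θ : ℝ} (hθ : θ ≠ 0) (h1 : |θ| ≤ 1) :
    |filonGamma θ - 4 / 3| ≤ |θ| := by
  set Es := Real.sin θ - (θ - θ ^ 3 / 6) with hEs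
  set Ec := Real.cos θ - (1 - θ ^ 2 / 2) with hEc
  have hs : |Es| ≤ |θ| ^ 5 / 100 := Real.sin_bound h1
  have hc : |Ec| ≤ |θ| ^ 4 * (5 / 96) := Real.cos_bound h1
  have key : filonGamma θ - 4 / 3 = 4 * (Es - θ * Ec) / θ ^ 3 := by
    unfold filonGamma
    rw [hEs, hEc]
    field_simp
    ring
  rw [key, abs_div, abs_mul, abs_pow, show |(4:ℝ)| = 4 by norm_num]
  have hθ3 : 0 < |θ| ^ 3 := by positivity
  rw [div_le_iff₀ hθ3]
  have htri : |Es - θ * Ec| ≤ |Es| + |θ| * |Ec| := by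
    calc |Es - θ * Ec| ≤ |Es| + |θ * Ec| := abs_sub _ _
      _ = |Es| + |θ| * |Ec| := by rw [abs_mul]
  have ha : 0 ≤ |θ| := abs_nonneg θ
  nlinarith [htri, hs, hc, mul_nonneg ha (abs_nonneg Ec), pow_le_one₀ ha h1 (n := 2),
    pow_nonneg ha 2, pow_nonneg ha 3, pow_nonneg ha 4, pow_nonneg ha 5,
    mul_le_mul_of_nonneg_left h1 (pow_nonneg ha 4)]


/-- `|β(θ) − 2/3| ≤ |θ|` for `0 < |θ| ≤ 1/2`: with `cos²θ = ½ + ½cos 2θ`, `2 sin θ cos θ = sin 2θ` and the Taylor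
remainders `E₁ = sin 2θ − (2θ − (2θ)³/6)`, `E₂ = cos 2θ − (1 − (2θ)²/2)`:
`θ(1 + cos²θ) − sin 2θ = θ³/3 + θE₂/2 − E₁`. [cite: DavisRabinowitz1984, Sect. 2.10.2 (2.10.2.11)] -/
private theorem abs_filonBeta_sub_le {θ : ℝ} (hθ : θ ≠ 0) (h1 : |θ| ≤ 1 / 2) :
    |filonBeta θ - 2 / 3| ≤ |θ| := by
  have h2 : |2 * θ| ≤ 1 := by rw [abs_mul, show |(2:ℝ)| = 2 by norm_num]; linarith
  set E1 := Real.sin (2 * θ) - (2 * θ - (2 * θ) ^ 3 / 6) with hE1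
  set E2 := Real.cos (2 * θ) - (1 - (2 * θ) ^ 2 / 2) with hE2
  have hs : |E1| ≤ |2 * θ| ^ 5 / 100 := Real.sin_bound h2
  have hc : |E2| ≤ |2 * θ| ^ 4 * (5 / 96) := Real.cos_bound h2
  rw [abs_mul, show |(2:ℝ)| = 2 by norm_num] at hs hc
  have key : filonBeta θ - 2 / 3 = (θ * E2 - 2 * E1) / θ ^ 3 := by
    unfold filonBeta
    rw [Real.cos_sq θ, ← Real.sin_two_mul, hE1, hE2]
    field_simp
    ring
  rw [key, abs_div, abs_pow]
  have hθ3 : 0 < |θ| ^ 3 := by positivity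
  rw [div_le_iff₀ hθ3]
  have htri : |θ * E2 - 2 * E1| ≤ |θ| * |E2| + 2 * |E1| := by
    calc |θ * E2 - 2 * E1| ≤ |θ * E2| + |2 * E1| := abs_sub _ _
      _ = |θ| * |E2| + 2 * |E1| := by rw [abs_mul, abs_mul, show |(2:ℝ)| = 2 by norm_num]
  have ha : 0 ≤ |θ| := abs_nonneg θ
  nlinarith [htri, hs, hc, mul_nonneg ha (abs_nonneg E2), abs_nonneg E1,
    pow_nonneg ha 2, pow_nonneg ha 3, pow_nonneg ha 4, pow_nonneg ha 5,
    mul_le_mul_of_nonneg_left h1 (pow_nonneg ha 4), mul_le_mul_of_nonneg_left h1 (pow_nonneg ha 3)]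

/-- `|α(θ)| ≤ 2|θ|` for `0 < |θ| ≤ 1/2`: with `θ sin θ cos θ = (θ/2) sin 2θ`, `2 sin²θ = 1 − cos 2θ`:
`θ² + θ sin θ cos θ − 2 sin²θ = −(2/3)θ⁴ + θE₁/2 + E₂`. [cite: DavisRabinowitz1984, Sect. 2.10.2 (2.10.2.11)] -/
private theorem abs_filonAlpha_le {θ : ℝ} (hθ : θ ≠ 0) (h1 : |θ| ≤ 1 / 2) :
    |filonAlpha θ - 0| ≤ 2 * |θ| := by
  have h2 : |2 * θ| ≤ 1 := by rw [abs_mul, show |(2:ℝ)| = 2 by norm_num]; linarith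
  set E1 := Real.sin (2 * θ) - (2 * θ - (2 * θ) ^ 3 / 6) with hE1
  set E2 := Real.cos (2 * θ) - (1 - (2 * θ) ^ 2 / 2) with hE2
  have hs : |E1| ≤ |2 * θ| ^ 5 / 100 := Real.sin_bound h2
  have hc : |E2| ≤ |2 * θ| ^ 4 * (5 / 96) := Real.cos_bound h2
  rw [abs_mul, show |(2:ℝ)| = 2 by norm_num] at hs hc
  have key : filonAlpha θ - 0 = (-(2 / 3) * θ ^ 4 + θ * E1 / 2 + E2) / θ ^ 3 := by
    unfold filonAlpha
    rw [show θ * Real.sin θ * Real.cos θ = θ / 2 * (2 * Real.sin θ * Real.cos θ) by ring,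
      ← Real.sin_two_mul, Real.sin_sq, Real.cos_sq θ, hE1, hE2]
    field_simp
    ring
  rw [key, abs_div, abs_pow]
  have hθ3 : 0 < |θ| ^ 3 := by positivity
  rw [div_le_iff₀ hθ3]
  have htri : |-(2 / 3) * θ ^ 4 + θ * E1 / 2 + E2| ≤ 2 / 3 * |θ| ^ 4 + |θ| * |E1| / 2 + |E2| := by
    calc |-(2 / 3) * θ ^ 4 + θ * E1 / 2 + E2|
        ≤ |-(2 / 3) * θ ^ 4 + θ * E1 / 2| + |E2| := abs_add_le _ _
      _ ≤ |-(2 / 3) * θ ^ 4| + |θ * E1 / 2| + |E2| := by linarith [abs_add_le (-(2 / 3) * θ ^ 4) (θ * E1 / 2)]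
      _ = 2 / 3 * |θ| ^ 4 + |θ| * |E1| / 2 + |E2| := by
          rw [abs_mul, abs_div, abs_mul, abs_pow, show |(-(2/3):ℝ)| = 2/3 by norm_num,
            show |(2:ℝ)| = 2 by norm_num]
  have ha : 0 ≤ |θ| := abs_nonneg θ
  nlinarith [htri, hs, hc, mul_nonneg ha (abs_nonneg E1), abs_nonneg E2,
    pow_nonneg ha 2, pow_nonneg ha 3, pow_nonneg ha 4, pow_nonneg ha 5, pow_nonneg ha 6,
    mul_le_mul_of_nonneg_left h1 (pow_nonneg ha 3), mul_le_mul_of_nonneg_left h1 (pow_nonneg ha 5),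
    mul_le_mul_of_nonneg_left h1 (pow_nonneg ha 4)]

/-- **(2.10.2.11), PROVED** (discharge of the cited fact `FilonSmallTheta`): `α(θ) → 0`, `β(θ) → 2/3`,
`γ(θ) → 4/3` as `θ → 0`, `θ ≠ 0` — with the explicit rates `|α(θ)| ≤ 2|θ|`, `|β(θ) − 2/3| ≤ |θ|`
(`|θ| ≤ ½`) and `|γ(θ) − 4/3| ≤ |θ|` (`|θ| ≤ 1`) from the Taylor remainders of `sin` and `cos`
(`Real.sin_bound`, `Real.cos_bound`). [cite: DavisRabinowitz1984, Sect. 2.10.2 (2.10.2.11)] -/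
theorem FilonSmallTheta_holds : FilonSmallTheta := by
  refine ⟨?_, ?_, ?_⟩
  · exact tendsto_punctured_of_abs_sub_le (by norm_num : (0:ℝ) < 1 / 2) (by norm_num)
      (fun θ hθ h ↦ abs_filonAlpha_le hθ h)
  · exact tendsto_punctured_of_abs_sub_le (by norm_num : (0:ℝ) < 1 / 2) zero_le_one
      (fun θ hθ h ↦ by simpa using abs_filonBeta_sub_le hθ h)
  · exact tendsto_punctured_of_abs_sub_le zero_lt_one zero_le_one
      (fun θ hθ h ↦ by simpa using abs_filonGamma_sub_le hθ h)

end Literature.Analysis.Quadrature
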